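import Literature.Geometry.Riemannian.SchrodingerGroundState
import Literature.Geometry.Riemannian.KarpukhinSternHarmonicMapsProofs
import HarnessLib

/-!
# Karpukhin–Stern Proposition 3.8 (stabilisation in a fixed equatorial subsphere) from the
# uniform `L⁶` bound, by a Rellich–Sobolev compactness count
(fourth proof file of `KarpukhinSternHarmonicMaps.lean`; topic `Geometry/Riemannian`)

Toward `Literature.Geometry.Riemannian.karpukhinStern_groundStateHarmonicMap` (Karpukhin–Stern,
Invent. Math. 236 (2024), Cor. 1.3 with Thm. 1.5). Proposition 3.8 (p. 752) is the input
"`u_k(M)` lies in a totally geodesic `S^{k₀}`" of the endgame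
`KarpukhinStern.groundState_of_harmonic_of_energyIndex_le` (`KarpukhinSternHarmonicMapsProofs.lean`).
Its printed proof (p. 753) argues by contradiction from the uniform bounds of Lemma 3.7 through the
spectral theory of weighted eigenvalue problems `Δf = λ(W)Wf`, `W ∈ L^{n/2}` ([14, Example 3.19,
Prop. 5.1]: discreteness and continuity of `λ_m(W)` under `L^{n/2}`-convergence of weights, plus
the energy gap of Prop. 5.5 to exclude `W = 0`). We PROVE the proposition from the single
hypothesis "(3.8): `∫|du|⁶ ≤ C` for nonconstant harmonic `u : N → Sᵏ`, `k ≥ 205`,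
`ind_E(u) ≤ k + 1`" (the conclusion of `KarpukhinStern.karpukhinStern_lemma37_of_lemma36`) by a
direct route that needs neither the limit weight nor the energy gap:

* the coordinate functions `u_a = ⟨u, a⟩`, `a ∈ span u(N)`, satisfy `∫|du_a|² = ∫|du|² u_a²`
  (Green's identity with `tr Hess u_a = −|du|²u_a`; `integral_gradSq_sphereComp_eq`) and form a
  space of dimension `dim span u(N)` (`eq_zero_of_sphereComp_eq_zero`) — Karpukhin–Stern's
  "`C_k`, `m_k := dim C_k`";
* **`exists_finrank_le_of_schrodinger_nonpos`**: on a closed Riemannian manifold of dimension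
  `3 ≤ m ≤ 5`, for every `C` there is `D` such that for every continuous `V ≥ 0` with `∫V³ ≤ C`,
  every finite-dimensional space of smooth functions on which `∫|df|² ≤ ∫Vf²` has dimension `≤ D`.
  Ingredients: an `L²`-orthonormal basis (`LinearMap.BilinForm.exists_orthogonal_basis`); the
  uniform `W^{1,2}` bound `exists_gradSq_le_of_schrodinger_nonpos` for unit vectors with
  `∫|df|² ≤ ∫Vf²` — Hölder `∫Vf² ≤ ‖V‖₃‖f‖₃²` (`integral_mul_sq_le_L3`), the fixed-exponent
  interpolation `∫|f|³ ≤ (∫f²)^{1/4}(∫|f|^{10/3})^{3/4}` (`integral_abs_cube_le`) and the Sobolev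
  inequality of `SobolevClosedManifold.lean` with `p = 10m/(3m+10) ≤ 2`, `p* = 10/3`
  (`exists_sobolev_ten_thirds`), giving `∫|df|² ≤ C^{1/3}(c₁(∫|df|²)^{1/2} + c₂)^{5/3}`; and
  **`exists_bound_orthonormal_of_gradSq_le`**: `L²`-orthonormal `C¹` families with `∫|df|² ≤ R`
  are uniformly finite, by the Rellich–Kondrachov theorem on the closed manifold
  (`exists_subseq_tendsto_eLpNorm_of_gradSq_bounded`, `SchrodingerGroundState.lean`) through the
  abstract `exists_bound_of_separated` (a greedy extraction of a `½`-separated sequence);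
* **`karpukhinStern_prop38_of_L6bound`** — Prop. 3.8: a `k₀` with `dim span u(N) ≤ k₀` for every
  smooth harmonic `u : N → Sᵏ` with `ind_E(u) ≤ k + 1` (any `k`; `k < 205` and constant maps
  being trivial).

Everything is proved; no definitions, no named facts. With `KarpukhinSternStabilization.lean`
(Lemma 3.7 from Lemma 3.6) and the endgame, the named fact is thereby reduced to KS Thm. 3.2
(existence, §2) and Lemma 3.6 (energy monotonicity and the energy gap Prop. 5.5).

## References

* M. Karpukhin, D. Stern, *Existence of harmonic maps and eigenvalue optimization in higher
  dimensions*, Invent. Math. 236 (2024) 713–778, §3.2, Prop. 3.8 and its proof (pp. 752–753).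
  [KarpukhinStern2024]
* T. Aubin, *Nonlinear Analysis on Manifolds*, Springer 1982, Thm. 2.21 (Sobolev), Thm. 2.34
  (Kondrakov) — as formalised in `SobolevClosedManifold.lean`, `SchrodingerGroundState.lean`.
  [Aubin1982]
-/

noncomputable section

open Module Finset Filter
open scoped InnerProductSpace BigOperators Manifold ContDiff Topology ENNReal NNReal

namespace Literature.Geometry.Riemannian

namespace KarpukhinStern

/-! ### Part I — separated families in a sequentially precompact set are uniformly finite -/

section Separated

/-- **Sequential precompactness bounds the size of separated families.** Let `d` be an
`ℝ≥0∞`-valued symmetric "distance" on `X` satisfying the triangle inequality on `B ⊆ X`, and suppose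
every sequence in `B` has two terms at `d`-distance `< ½` (e.g. `B` is sequentially precompact).
Then there is `D` such that every `1`-separated family in `B` has at most `D` members. (Otherwise a
greedy extraction — each point of a finite set is `½`-close to at most ONE member of a
`1`-separated family — produces an infinite `½`-separated sequence in `B`.) The finiteness behind
"the eigenvalues … form a discrete sequence" in Karpukhin–Stern's proof of Prop. 3.8 (p. 753),
here in the Rellich–Kondrachov form. [cite: KarpukhinStern2024, proof of Prop. 3.8 p. 753] -/
theorem exists_bound_of_separated {X : Type*} (B : Set X) (d : X → X → ℝ≥0∞)
    (hsymm : ∀ x y, d x y = d y x) (htri : ∀ x ∈ B, ∀ y ∈ B, ∀ z ∈ B, d x z ≤ d x y + d y z)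
    (hB : ∀ s : ℕ → X, (∀ n, s n ∈ B) → ∃ i j, i < j ∧ d (s i) (s j) < 1 / 2) :
    ∃ D : ℕ, ∀ (n : ℕ) (S : Fin n → X), (∀ i, S i ∈ B) → (∀ i j, i ≠ j → 1 ≤ d (S i) (S j)) → n ≤ D := by
  classical
  by_contra hcon
  push Not at hcon
  -- `hcon : ∀ D, ∃ n S, (∀ i, S i ∈ B) ∧ (1-separated) ∧ D < n`
  -- the extension step
  have hext : ∀ s : Finset X, (∀ x ∈ s, x ∈ B) → ∃ y, y ∈ B ∧ ∀ x ∈ s, 1 / 2 ≤ d x y := by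
    intro s hs
    obtain ⟨n, S, hSB, hsep, hn⟩ := hcon s.card
    -- indices blocked by some `x ∈ s`
    set J : Finset (Fin n) := Finset.univ.filter fun j ↦ ∃ x ∈ s, d x (S j) < 1 / 2 with hJ
    have hJle : J.card ≤ s.card := by
      have hsub : J ⊆ s.biUnion fun x ↦ Finset.univ.filter fun j ↦ d x (S j) < 1 / 2 := by
        intro j hj
        simp only [hJ, Finset.mem_filter, Finset.mem_univ, true_and] at hj
        obtain ⟨x, hx, hxj⟩ := hj
        exact Finset.mem_biUnion.2 ⟨x, hx, by simpa using hxj⟩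
      refine (Finset.card_le_card hsub).trans ((Finset.card_biUnion_le).trans ?_)
      have hone : ∀ x ∈ s, (Finset.univ.filter fun j ↦ d x (S j) < 1 / 2).card ≤ 1 := by
        intro x hx
        refine Finset.card_le_one.2 fun j hj j' hj' ↦ ?_
        simp only [Finset.mem_filter, Finset.mem_univ, true_and] at hj hj'
        by_contra hjj
        have h1 : 1 ≤ d (S j) (S j') := hsep j j' hjj
        have h2 : d (S j) (S j') ≤ d (S j) x + d x (S j') := htri _ (hSB j) _ (hs x hx) _ (hSB j')
        rw [hsymm (S j) x] at h2
        have h3 : d x (S j) + d x (S j') < 1 / 2 + 1 / 2 := ENNReal.add_lt_add hj hj'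
        rw [ENNReal.add_halves] at h3
        exact absurd (h1.trans h2) (not_le.2 h3)
      calc ∑ x ∈ s, (Finset.univ.filter fun j ↦ d x (S j) < 1 / 2).card ≤ ∑ _x ∈ s, 1 :=
            Finset.sum_le_sum hone
        _ = s.card := by simp
    have hlt : J.card < (Finset.univ : Finset (Fin n)).card := by
      rw [Finset.card_univ, Fintype.card_fin]
      exact lt_of_le_of_lt hJle hn
    obtain ⟨j, -, hj⟩ := Finset.exists_mem_notMem_of_card_lt_card hlt
    refine ⟨S j, hSB j, fun x hx ↦ ?_⟩
    by_contra hlt'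
    push Not at hlt'
    exact hj (by simp only [hJ, Finset.mem_filter, Finset.mem_univ, true_and]; exact ⟨x, hx, hlt'⟩)
  obtain ⟨g, hgB, hg⟩ := exists_seq_of_forall_finset_exists (fun x ↦ x ∈ B) (fun x y ↦ 1 / 2 ≤ d x y) hext
  obtain ⟨i, j, hij, hd⟩ := hB g hgB
  exact absurd (hg i j hij) (not_le.2 hd)

end Separated

section Rellich

open Lorentzian Lorentzian.PseudoRiemannianMetric Bundle
open _root_.MeasureTheory

variable {m : ℕ} {H' : Type*} [TopologicalSpace H']
  {J : ModelWithCorners ℝ (EuclideanSpace ℝ (Fin m)) H'} [J.Boundaryless]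
  {N : Type*} [TopologicalSpace N] [ChartedSpace H' N] [IsManifold J ∞ N] [CompactSpace N]
  [T2Space N] [T3Space N] [MeasurableSpace N] [BorelSpace N]
  (h : ContMDiffRiemannianMetric J ∞ (EuclideanSpace ℝ (Fin m)) (TangentSpace J : N → Type _))

omit [J.Boundaryless] [CompactSpace N] [T2Space N] in
/-- The total Riemannian volume of `ofRiemannian h` is `riemannianMeasure h`. [folklore] -/
theorem riemVolume_ofRiemannian : (ofRiemannian h).riemVolume = riemannianMeasure h :=
  (ofRiemannian h).riemVolume_eq (isRiemannian_ofRiemannian h)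

omit [J.Boundaryless] in
/-- `‖f‖_{L²} = √(∫ f²)` for a continuous function on the closed manifold. [folklore] -/
theorem toReal_eLpNorm_two_of_continuous {f : N → ℝ} (hf : Continuous f) :
    (eLpNorm f 2 (riemannianMeasure h)).toReal = Real.sqrt (∫ x, f x ^ 2 ∂riemannianMeasure h) :=
  toReal_eLpNorm_two_eq_sqrt' (integrable_of_continuous h (hf.pow 2))

omit [J.Boundaryless] [T2Space N] in
/-- Continuous functions on the closed manifold are in `L²`. [folklore] -/
theorem eLpNorm_two_ne_top_of_continuous {f : N → ℝ} (hf : Continuous f) :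
    eLpNorm f 2 (riemannianMeasure h) ≠ ⊤ := by
  haveI := isFiniteMeasure_riemannianMeasure h
  obtain ⟨C, hC⟩ := isCompact_univ.exists_bound_of_continuousOn (f := f) hf.continuousOn
  exact (MemLp.of_bound hf.aestronglyMeasurable C
    (Eventually.of_forall fun x ↦ hC x (Set.mem_univ x))).eLpNorm_ne_top

/-- **`L²`-orthonormal `C¹` families with bounded Dirichlet energy are uniformly finite**: for
every `R` there is `D = D(N, h, R)` such that any `L²(dv_h)`-orthonormal family of `C¹` functions
`f₁, …, fₙ` with `∫ |dfᵢ|²_h ≤ R` has `n ≤ D` — the Rellich–Kondrachov theorem on the closed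
manifold (`exists_subseq_tendsto_eLpNorm_of_gradSq_bounded`) through `exists_bound_of_separated`
(orthonormal functions are `√2`-separated in `L²`). This is the compactness that makes the number
of non-positive directions of a Schrödinger form finite, the engine of the contradiction in
Karpukhin–Stern's proof of Prop. 3.8 (p. 753, "`m_k := dim C_k → ∞` … the eigenvalues … form a
discrete sequence"). [cite: KarpukhinStern2024, proof of Prop. 3.8 p. 753] -/
theorem exists_bound_orthonormal_of_gradSq_le (R : ℝ) :
    ∃ D : ℕ, ∀ (n : ℕ) (f : Fin n → N → ℝ), (∀ i, ContMDiff J 𝓘(ℝ, ℝ) 1 (f i)) →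
      (∀ i j, ∫ x, f i x * f j x ∂riemannianMeasure h = if i = j then 1 else 0) →
      (∀ i, ∫ x, (ofRiemannian h).gradSq (f i) x ∂riemannianMeasure h ≤ R) → n ≤ D := by
  classical
  set g := ofRiemannian h with hg
  set μ := riemannianMeasure h with hμ
  have hgR : g.IsRiemannian := isRiemannian_ofRiemannian h
  have hvol : g.riemVolume = μ := riemVolume_ofRiemannian h
  haveI := isFiniteMeasure_riemannianMeasure h
  set Rb : ℝ≥0∞ := ENNReal.ofReal (Real.sqrt (max R 0)) with hRb
  set B : Set (N → ℝ) := {f | ContMDiff J 𝓘(ℝ, ℝ) 1 f ∧ eLpNorm f 2 μ ≤ 1 ∧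
    eLpNorm (fun x ↦ Real.sqrt (g.gradSq f x)) 2 μ ≤ Rb} with hB
  set d : (N → ℝ) → (N → ℝ) → ℝ≥0∞ := fun f f' ↦ eLpNorm (f - f') 2 μ with hd
  have hsymm : ∀ f f', d f f' = d f' f := fun f f' ↦ eLpNorm_sub_comm f f' 2 μ
  have htri : ∀ f ∈ B, ∀ f' ∈ B, ∀ f'' ∈ B, d f f'' ≤ d f f' + d f' f'' := by
    intro f hf f' hf' f'' hf''
    have h1 : f - f'' = (f - f') + (f' - f'') := by abel
    simp only [hd]
    rw [h1]
    exact eLpNorm_add_le (hf.1.continuous.aestronglyMeasurable.sub hf'.1.continuous.aestronglyMeasurable)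
      (hf'.1.continuous.aestronglyMeasurable.sub hf''.1.continuous.aestronglyMeasurable) one_le_two
  have hseq : ∀ s : ℕ → N → ℝ, (∀ n, s n ∈ B) → ∃ i j, i < j ∧ d (s i) (s j) < 1 / 2 := by
    intro s hs
    obtain ⟨F, ψ, hψ, hF, hlim⟩ := exists_subseq_tendsto_eLpNorm_of_gradSq_bounded g hgR (p := 2)
      one_le_two s (fun n ↦ (hs n).1) ENNReal.one_ne_top (by simp [hRb] : Rb ≠ ⊤)
      (fun n ↦ by rw [hvol]; exact_mod_cast (hs n).2.1) (fun n ↦ by rw [hvol]; exact_mod_cast (hs n).2.2)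
    rw [hvol] at hlim hF
    have hquarter : ∀ᶠ k in atTop, eLpNorm (s (ψ k) - F) 2 μ < 1 / 2 / 2 :=
      (tendsto_order.1 hlim).2 _ (ENNReal.half_pos (ENNReal.half_pos one_ne_zero).ne')
    obtain ⟨K, hK⟩ := hquarter.exists_forall_of_atTop
    refine ⟨ψ K, ψ (K + 1), hψ (Nat.lt_succ_self K), ?_⟩
    have h1 : s (ψ K) - s (ψ (K + 1)) = (s (ψ K) - F) + (F - s (ψ (K + 1))) := by abel
    have hFm : AEStronglyMeasurable F μ := hF.1
    have hsK : AEStronglyMeasurable (s (ψ K)) μ := (hs _).1.continuous.aestronglyMeasurable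
    have hsK1 : AEStronglyMeasurable (s (ψ (K + 1))) μ := (hs _).1.continuous.aestronglyMeasurable
    calc d (s (ψ K)) (s (ψ (K + 1))) = eLpNorm ((s (ψ K) - F) + (F - s (ψ (K + 1)))) 2 μ := by
          simp only [hd]; rw [h1]
      _ ≤ eLpNorm (s (ψ K) - F) 2 μ + eLpNorm (F - s (ψ (K + 1))) 2 μ :=
          eLpNorm_add_le (hsK.sub hFm) (hFm.sub hsK1) one_le_two
      _ < 1 / 2 / 2 + 1 / 2 / 2 := by
          refine ENNReal.add_lt_add (hK K le_rfl) ?_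
          rw [eLpNorm_sub_comm]
          exact hK (K + 1) (Nat.le_succ K)
      _ = 1 / 2 := ENNReal.add_halves _
  obtain ⟨D, hD⟩ := exists_bound_of_separated B d hsymm htri hseq
  refine ⟨D, fun n f hf horth hgrad ↦ hD n (fun i ↦ f i) (fun i ↦ ?_) (fun i j hij ↦ ?_)⟩
  · -- membership in `B`
    have hfc : Continuous (f i) := (hf i).continuous
    refine ⟨hf i, ?_, ?_⟩
    · have h1 : (eLpNorm (f i) 2 μ).toReal = 1 := by
        rw [hμ, toReal_eLpNorm_two_of_continuous h hfc]
        have := horth i i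
        simp only [if_true] at this
        rw [show (∫ x, f i x ^ 2 ∂riemannianMeasure h) = 1 by
          rw [← this]; exact integral_congr_ae (Eventually.of_forall fun x ↦ by simp [sq])]
        exact Real.sqrt_one
      exact ((ENNReal.toReal_eq_one_iff _).1 h1).le
    · have hgc : Continuous fun x ↦ Real.sqrt (g.gradSq (f i) x) :=
        Real.continuous_sqrt.comp (continuous_innerDual_mvfderiv g (hf i) (hf i))
      have hne : eLpNorm (fun x ↦ Real.sqrt (g.gradSq (f i) x)) 2 μ ≠ ⊤ :=
        eLpNorm_two_ne_top_of_continuous h hgc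
      rw [hRb, ENNReal.le_ofReal_iff_toReal_le hne (Real.sqrt_nonneg _), hμ,
        toReal_eLpNorm_two_of_continuous h hgc]
      refine Real.sqrt_le_sqrt ?_
      have h2 : ∫ x, Real.sqrt (g.gradSq (f i) x) ^ 2 ∂riemannianMeasure h =
          ∫ x, g.gradSq (f i) x ∂riemannianMeasure h :=
        integral_congr_ae (Eventually.of_forall fun x ↦ Real.sq_sqrt (innerDual_self_nonneg h x _))
      rw [h2]
      exact (hgrad i).trans (le_max_left _ _)
  · -- `1`-separation: `‖fᵢ − fⱼ‖₂ = √2`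
    have hfc : ∀ i, Continuous (f i) := fun i ↦ (hf i).continuous
    have hne : eLpNorm (f i - f j) 2 μ ≠ ⊤ :=
      eLpNorm_two_ne_top_of_continuous h ((hfc i).sub (hfc j))
    have h1 : (eLpNorm (f i - f j) 2 μ).toReal = Real.sqrt 2 := by
      rw [hμ, toReal_eLpNorm_two_of_continuous h ((hfc i).sub (hfc j))]
      congr 1
      have hint : ∀ a b : Fin n, Integrable (fun x ↦ f a x * f b x) (riemannianMeasure h) :=
        fun a b ↦ integrable_of_continuous h ((hfc a).mul (hfc b))
      have hexp : ∫ x, (f i - f j) x ^ 2 ∂riemannianMeasure h =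
          ∫ x, (f i x * f i x - 2 * (f i x * f j x) + f j x * f j x) ∂riemannianMeasure h :=
        integral_congr_ae (Eventually.of_forall fun x ↦ by simp only [Pi.sub_apply]; ring)
      have hI2 : Integrable (fun x ↦ 2 * (f i x * f j x)) (riemannianMeasure h) := (hint i j).const_mul 2
      have hI1 : Integrable (fun x ↦ f i x * f i x - 2 * (f i x * f j x)) (riemannianMeasure h) :=
        (hint i i).sub hI2
      rw [hexp, integral_add hI1 (hint j j), integral_sub (hint i i) hI2, integral_const_mul]
      have h1 := horth i i
      have h2 := horth i j
      have h3 := horth j j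
      simp only [if_true, hμ] at h1 h3
      simp only [hij, if_false, hμ] at h2
      rw [h1, h2, h3]
      norm_num
    change 1 ≤ eLpNorm (f i - f j) 2 μ
    rw [← ENNReal.ofReal_one, ENNReal.ofReal_le_iff_le_toReal hne, h1]
    exact Real.one_le_sqrt.2 one_le_two

end Rellich

section CoordinateFunctions

open Lorentzian Lorentzian.PseudoRiemannianMetric Bundle
open _root_.MeasureTheory

variable {m : ℕ} {H' : Type*} [TopologicalSpace H']
  {J : ModelWithCorners ℝ (EuclideanSpace ℝ (Fin m)) H'} [J.Boundaryless]
  {N : Type*} [TopologicalSpace N] [ChartedSpace H' N] [IsManifold J ∞ N] [CompactSpace N]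
  [T2Space N] [MeasurableSpace N] [BorelSpace N]
  (h : ContMDiffRiemannianMetric J ∞ (EuclideanSpace ℝ (Fin m)) (TangentSpace J : N → Type _))
  [(ofRiemannian h).HasLeviCivita] {k : ℕ}

/-- **Coordinate functions of a harmonic map are null directions of the Schrödinger form**
(Karpukhin–Stern p. 753: "It follows from the defining equation `Δu_k = |du_k|²u_k` … that the
coordinate functions of `u_k` are eigenfunctions of the problem `Δf = λ(V_k)V_k f` with eigenvalue
`λ(V_k) = 1`"): for a smooth harmonic `u : N → Sᵏ` and every `a ∈ ℝᵏ⁺¹`, with `u_a = ⟨u, a⟩` and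
`e = |du|²_h`, `∫ |du_a|²_h dv_h = ∫ e u_a² dv_h` (Green's identity with `tr Hess u_a = −e u_a`).
[cite: KarpukhinStern2024, proof of Prop. 3.8 p. 753] -/
theorem integral_gradSq_sphereComp_eq
    {u : N → Metric.sphere (0 : EuclideanSpace ℝ (Fin (k + 1))) 1} (hu : ContMDiff J (𝓡 k) ∞ u)
    (harm : ∀ (i : Fin (k + 1)) (x : N), (ofRiemannian h).dalembertian
      (fun y ↦ (u y : EuclideanSpace ℝ (Fin (k + 1))) i) x =
        -(energyDensity h u x) * (u x : EuclideanSpace ℝ (Fin (k + 1))) i)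
    (a : EuclideanSpace ℝ (Fin (k + 1))) :
    ∫ x, (ofRiemannian h).gradSq (sphereComp u a) x ∂riemannianMeasure h =
      ∫ x, energyDensity h u x * sphereComp u a x ^ 2 ∂riemannianMeasure h := by
  set f := sphereComp u a with hfdef
  have hf : ContMDiff J 𝓘(ℝ, ℝ) ∞ f := contMDiff_sphereComp hu a
  have hLap : ∀ y, (ofRiemannian h).dalembertian f y = -(energyDensity h u y * f y) := by
    intro y
    rw [hfdef, dalembertian_sphereComp h hu a y]
    simp only [harm, sphereComp, Finset.mul_sum]
    rw [← Finset.sum_neg_distrib]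
    exact Finset.sum_congr rfl fun i _ ↦ by ring
  have hGreen := integral_mul_dalembertian_eq_neg_integral_innerDual h (u := f) (f := f)
    (hf.of_le (by exact_mod_cast le_top)) (hf.of_le (WithTop.coe_le_coe.mpr le_top))
  simp_rw [hLap] at hGreen
  rw [integral_congr_ae (Eventually.of_forall fun x ↦ (show f x * -(energyDensity h u x * f x) =
      -(energyDensity h u x * f x ^ 2) by ring)), integral_neg, neg_inj] at hGreen
  rw [hGreen]
  rfl

omit [J.Boundaryless] [IsManifold J ∞ N] [CompactSpace N] [T2Space N] [MeasurableSpace N] [BorelSpace N]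
  [(ofRiemannian h).HasLeviCivita] [TopologicalSpace N] in
/-- `a ↦ u_a` is injective on the span of the image of `u`: if `a ∈ span(u(N))` and `⟨u(x), a⟩ = 0`
for all `x` then `a = 0`. Hence `dim span{u_a} = dim span(u(N))`, Karpukhin–Stern's `m_k` (p. 753).
[cite: KarpukhinStern2024, proof of Prop. 3.8 p. 753] -/
theorem eq_zero_of_sphereComp_eq_zero (u : N → Metric.sphere (0 : EuclideanSpace ℝ (Fin (k + 1))) 1)
    {a : EuclideanSpace ℝ (Fin (k + 1))}
    (ha : a ∈ Submodule.span ℝ (Set.range fun x ↦ (u x : EuclideanSpace ℝ (Fin (k + 1)))))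
    (h0 : ∀ x, sphereComp u a x = 0) : a = 0 := by
  -- `a` is orthogonal to the span, hence to itself
  have horth : ∀ v ∈ Submodule.span ℝ (Set.range fun x ↦ (u x : EuclideanSpace ℝ (Fin (k + 1)))),
      ⟪v, a⟫_ℝ = 0 := by
    intro v hv
    refine Submodule.span_induction (fun w hw ↦ ?_) (by simp) (fun v w _ _ hv hw ↦ ?_)
      (fun c v _ hv ↦ ?_) hv
    · obtain ⟨x, rfl⟩ := hw
      rw [inner_coe_eq_sphereComp]
      exact h0 x
    · rw [inner_add_left, hv, hw, add_zero]
    · rw [inner_smul_left, hv]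
      simp
  have := horth a ha
  exact inner_self_eq_zero.1 this

end CoordinateFunctions

/-! ### Part J — the `W^{1,2}` bound for unit vectors with `∫|df|² ≤ ∫ V f²`, `‖V‖_{L³} ≤ C` -/

section SobolevBound

open Lorentzian Lorentzian.PseudoRiemannianMetric Bundle
open _root_.MeasureTheory

variable {m : ℕ} {H' : Type*} [TopologicalSpace H']
  {J : ModelWithCorners ℝ (EuclideanSpace ℝ (Fin m)) H'} [J.Boundaryless]
  {N : Type*} [TopologicalSpace N] [ChartedSpace H' N] [IsManifold J ∞ N] [CompactSpace N]
  [T2Space N] [T3Space N] [MeasurableSpace N] [BorelSpace N]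
  (h : ContMDiffRiemannianMetric J ∞ (EuclideanSpace ℝ (Fin m)) (TangentSpace J : N → Type _))

omit [J.Boundaryless] [T2Space N] in
/-- Continuous functions on the closed manifold lie in every `L^q`. [folklore] -/
theorem memLp_of_continuous' {f : N → ℝ} (hf : Continuous f) (q : ℝ≥0∞) :
    MemLp f q (riemannianMeasure h) := by
  haveI := isFiniteMeasure_riemannianMeasure h
  obtain ⟨C, hC⟩ := isCompact_univ.exists_bound_of_continuousOn (f := f) hf.continuousOn
  exact MemLp.of_bound hf.aestronglyMeasurable C (Eventually.of_forall fun x ↦ hC x (Set.mem_univ x))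

omit [J.Boundaryless] [T2Space N] in
/-- **Hölder with exponents `3, 3/2`**: `∫ V f² ≤ (∫ V³)^{1/3} (∫ |f|³)^{2/3}` for continuous
`V ≥ 0` and `f`. Karpukhin–Stern p. 753 use `V ∈ L^{n/2}` against `f² ∈ L^{n/(n−2)}`; for `n ≤ 5`
the weaker pairing `L³ – L^{3/2}` (subcritical) suffices. [cite: KarpukhinStern2024, proof of Prop. 3.8 p. 753] -/
theorem integral_mul_sq_le_L3 {V f : N → ℝ} (hV : Continuous V) (hV0 : ∀ x, 0 ≤ V x) (hf : Continuous f) :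
    ∫ x, V x * f x ^ 2 ∂riemannianMeasure h ≤
      (∫ x, V x ^ (3 : ℝ) ∂riemannianMeasure h) ^ ((1 : ℝ) / 3) *
        (∫ x, |f x| ^ (3 : ℝ) ∂riemannianMeasure h) ^ ((2 : ℝ) / 3) := by
  have hpq : Real.HolderConjugate 3 (3 / 2) := Real.holderConjugate_iff.2 ⟨by norm_num, by norm_num⟩
  have hH := integral_mul_le_Lp_mul_Lq_of_nonneg (μ := riemannianMeasure h) hpq (f := V)
    (g := fun x ↦ f x ^ 2) (Eventually.of_forall hV0) (Eventually.of_forall fun x ↦ sq_nonneg (f x))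
    (memLp_of_continuous' h hV _) (memLp_of_continuous' h (hf.pow 2) _)
  have h1 : ∀ x, (f x ^ 2) ^ ((3 : ℝ) / 2) = |f x| ^ (3 : ℝ) := by
    intro x
    rw [← sq_abs, ← Real.rpow_natCast (|f x|) 2, ← Real.rpow_mul (abs_nonneg _)]
    norm_num
  simp_rw [h1] at hH
  have h2 : (1 : ℝ) / (3 / 2) = 2 / 3 := by norm_num
  rw [h2] at hH
  exact hH

omit [J.Boundaryless] [T2Space N] in
/-- **Interpolation `L³` between `L²` and `L^{10/3}` with fixed exponents**:
`∫ |f|³ ≤ (∫ f²)^{1/4} (∫ |f|^{10/3})^{3/4}` (Hölder `4, 4/3` on `|f|^{1/2} · |f|^{5/2}`).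
[folklore] -/
theorem integral_abs_cube_le {f : N → ℝ} (hf : Continuous f) :
    ∫ x, |f x| ^ (3 : ℝ) ∂riemannianMeasure h ≤
      (∫ x, f x ^ 2 ∂riemannianMeasure h) ^ ((1 : ℝ) / 4) *
        (∫ x, |f x| ^ ((10 : ℝ) / 3) ∂riemannianMeasure h) ^ ((3 : ℝ) / 4) := by
  have hpq : Real.HolderConjugate 4 (4 / 3) := Real.holderConjugate_iff.2 ⟨by norm_num, by norm_num⟩
  have hc1 : Continuous fun x ↦ |f x| ^ ((1 : ℝ) / 2) :=
    (continuous_abs.comp hf).rpow_const fun x ↦ Or.inr (by norm_num)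
  have hc2 : Continuous fun x ↦ |f x| ^ ((5 : ℝ) / 2) :=
    (continuous_abs.comp hf).rpow_const fun x ↦ Or.inr (by norm_num)
  have hH := integral_mul_le_Lp_mul_Lq_of_nonneg (μ := riemannianMeasure h) hpq
    (f := fun x ↦ |f x| ^ ((1 : ℝ) / 2)) (g := fun x ↦ |f x| ^ ((5 : ℝ) / 2))
    (Eventually.of_forall fun x ↦ Real.rpow_nonneg (abs_nonneg _) _)
    (Eventually.of_forall fun x ↦ Real.rpow_nonneg (abs_nonneg _) _)
    (memLp_of_continuous' h hc1 _) (memLp_of_continuous' h hc2 _)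
  have e0 : ∀ x, |f x| ^ ((1 : ℝ) / 2) * |f x| ^ ((5 : ℝ) / 2) = |f x| ^ (3 : ℝ) := by
    intro x
    rw [← Real.rpow_add' (abs_nonneg _) (by norm_num)]
    norm_num
  have e1 : ∀ x, (|f x| ^ ((1 : ℝ) / 2)) ^ (4 : ℝ) = f x ^ 2 := by
    intro x
    rw [← Real.rpow_mul (abs_nonneg _)]
    norm_num
  have e2 : ∀ x, (|f x| ^ ((5 : ℝ) / 2)) ^ ((4 : ℝ) / 3) = |f x| ^ ((10 : ℝ) / 3) := by
    intro x
    rw [← Real.rpow_mul (abs_nonneg _)]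
    norm_num
  simp_rw [e0, e1, e2] at hH
  have h3 : (1 : ℝ) / (4 / 3) = 3 / 4 := by norm_num
  rw [h3] at hH
  exact hH

/-- **The Sobolev inequality with target exponent `10/3`, in integral form.** On a closed
Riemannian manifold of dimension `3 ≤ m ≤ 5` there are `c₁, c₂ ≥ 0` with
`(∫|f|^{10/3})^{3/10} ≤ c₁ (∫|df|²)^{1/2} + c₂ (∫f²)^{1/2}` for every `C¹` function `f`:
`exists_sobolev_const` with `p = 10m/(3m+10) ≤ 2` (so that `p* = 10/3` in every dimension
`m ∈ {3,4,5}`) followed by `L^p ≤ Vol^{1/p−1/2} L²`. [cite: KarpukhinStern2024, proof of Prop. 3.8 p. 753] -/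
theorem exists_sobolev_ten_thirds (hm3 : 3 ≤ m) (hm5 : m ≤ 5) :
    ∃ c₁ c₂ : ℝ, 0 ≤ c₁ ∧ 0 ≤ c₂ ∧ ∀ f : N → ℝ, ContMDiff J 𝓘(ℝ, ℝ) 1 f →
      (∫ x, |f x| ^ ((10 : ℝ) / 3) ∂riemannianMeasure h) ^ ((3 : ℝ) / 10) ≤
        c₁ * Real.sqrt (∫ x, (ofRiemannian h).gradSq f x ∂riemannianMeasure h) +
          c₂ * Real.sqrt (∫ x, f x ^ 2 ∂riemannianMeasure h) := by
  set g := ofRiemannian h with hg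
  set μ := riemannianMeasure h with hμ
  have hgR : g.IsRiemannian := isRiemannian_ofRiemannian h
  have hvol : g.riemVolume = μ := riemVolume_ofRiemannian h
  haveI := isFiniteMeasure_riemannianMeasure h
  have hm3' : (3 : ℝ) ≤ m := by exact_mod_cast hm3
  have hm5' : (m : ℝ) ≤ 5 := by exact_mod_cast hm5
  -- the exponent `p = 10m/(3m+10)`
  have hden : (0 : ℝ) < 3 * m + 10 := by linarith
  have hp0 : (0 : ℝ) ≤ 10 * m / (3 * m + 10) := div_nonneg (by linarith) hden.le
  set p : ℝ≥0 := ⟨10 * m / (3 * m + 10), hp0⟩ with hpdef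
  have hpR : (p : ℝ) = 10 * m / (3 * m + 10) := rfl
  have hp1 : 1 ≤ p := by
    rw [← NNReal.coe_le_coe, NNReal.coe_one, hpR, le_div_iff₀ hden]
    linarith
  have hp2 : (p : ℝ) ≤ 2 := by
    rw [hpR, div_le_iff₀ hden]
    linarith
  have hpm : (p : ℝ) < finrank ℝ (EuclideanSpace ℝ (Fin m)) := by
    rw [finrank_euclideanSpace_fin, hpR, div_lt_iff₀ hden]
    nlinarith
  set q : ℝ≥0 := ⟨(10 : ℝ) / 3, by norm_num⟩ with hqdef
  have hqR : (q : ℝ) = 10 / 3 := rfl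
  have hpq : (q : ℝ)⁻¹ = (p : ℝ)⁻¹ - (finrank ℝ (EuclideanSpace ℝ (Fin m)) : ℝ)⁻¹ := by
    rw [finrank_euclideanSpace_fin, hqR, hpR]
    have : (m : ℝ) ≠ 0 := by linarith
    field_simp
    ring
  obtain ⟨A, B, hAB⟩ := exists_sobolev_const g hgR hp1 hpm hpq
  -- the finite-measure comparison factor
  set W : ℝ≥0∞ := μ Set.univ ^ (1 / (p : ℝ≥0∞).toReal - 1 / (2 : ℝ≥0∞).toReal) with hW
  have hWexp : 0 ≤ 1 / (p : ℝ≥0∞).toReal - 1 / (2 : ℝ≥0∞).toReal := by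
    rw [ENNReal.coe_toReal, ENNReal.toReal_ofNat, sub_nonneg]
    have hp0' : 0 < (p : ℝ) := by rw [hpR]; positivity
    exact one_div_le_one_div_of_le hp0' hp2
  have hWtop : W ≠ ⊤ := ENNReal.rpow_ne_top_of_nonneg hWexp (measure_ne_top μ _)
  refine ⟨(A : ℝ) * W.toReal, (B : ℝ) * W.toReal, by positivity, by positivity, fun f hf ↦ ?_⟩
  have hfc : Continuous f := hf.continuous
  have hGc : Continuous fun x ↦ Real.sqrt (g.gradSq f x) :=
    Real.continuous_sqrt.comp (continuous_innerDual_mvfderiv g hf hf)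
  have hple : (p : ℝ≥0∞) ≤ 2 := by exact_mod_cast (show p ≤ 2 from NNReal.coe_le_coe.1 (by simpa using hp2))
  -- Sobolev and the comparison `L^p ≤ W · L²`
  have hS := hAB f hf
  rw [hvol] at hS
  have h1 : eLpNorm (fun x ↦ Real.sqrt (g.gradSq f x)) p μ ≤
      eLpNorm (fun x ↦ Real.sqrt (g.gradSq f x)) 2 μ * W :=
    eLpNorm_le_eLpNorm_mul_rpow_measure_univ hple hGc.aestronglyMeasurable
  have h2 : eLpNorm f p μ ≤ eLpNorm f 2 μ * W :=
    eLpNorm_le_eLpNorm_mul_rpow_measure_univ hple hfc.aestronglyMeasurable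
  have hS' : eLpNorm f q μ ≤ A * (eLpNorm (fun x ↦ Real.sqrt (g.gradSq f x)) 2 μ * W) +
      B * (eLpNorm f 2 μ * W) := hS.trans (add_le_add (mul_le_mul' le_rfl h1) (mul_le_mul' le_rfl h2))
  -- pass to real numbers
  have hX : eLpNorm (fun x ↦ Real.sqrt (g.gradSq f x)) 2 μ ≠ ⊤ := eLpNorm_two_ne_top_of_continuous h hGc
  have hY : eLpNorm f 2 μ ≠ ⊤ := eLpNorm_two_ne_top_of_continuous h hfc
  have hRHS : (A * (eLpNorm (fun x ↦ Real.sqrt (g.gradSq f x)) 2 μ * W) + B * (eLpNorm f 2 μ * W)) ≠ ⊤ :=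
    ENNReal.add_ne_top.2 ⟨ENNReal.mul_ne_top ENNReal.coe_ne_top (ENNReal.mul_ne_top hX hWtop),
      ENNReal.mul_ne_top ENNReal.coe_ne_top (ENNReal.mul_ne_top hY hWtop)⟩
  have hle := ENNReal.toReal_mono hRHS hS'
  rw [ENNReal.toReal_add (ENNReal.mul_ne_top ENNReal.coe_ne_top (ENNReal.mul_ne_top hX hWtop))
    (ENNReal.mul_ne_top ENNReal.coe_ne_top (ENNReal.mul_ne_top hY hWtop)), ENNReal.toReal_mul,
    ENNReal.toReal_mul, ENNReal.toReal_mul, ENNReal.toReal_mul, ENNReal.coe_toReal, ENNReal.coe_toReal,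
    hμ, toReal_eLpNorm_two_of_continuous h hGc, toReal_eLpNorm_two_of_continuous h hfc] at hle
  -- the left side
  have hq0 : (q : ℝ≥0∞) ≠ 0 := by
    rw [ne_eq, ENNReal.coe_eq_zero]
    exact fun h0 ↦ by have := congrArg (fun r : ℝ≥0 ↦ (r : ℝ)) h0; norm_num [hqR] at this
  have hLHS : (eLpNorm f q μ).toReal = (∫ x, |f x| ^ ((10 : ℝ) / 3) ∂μ) ^ ((3 : ℝ) / 10) := by
    rw [(memLp_of_continuous' h hfc q).eLpNorm_eq_integral_rpow_norm hq0 ENNReal.coe_ne_top,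
      ENNReal.toReal_ofReal (Real.rpow_nonneg (integral_nonneg fun x ↦ Real.rpow_nonneg (norm_nonneg _) _) _),
      ENNReal.coe_toReal, hqR]
    simp only [Real.norm_eq_abs]
    norm_num
    rfl
  rw [hLHS] at hle
  have hsq : ∫ x, Real.sqrt (g.gradSq f x) ^ 2 ∂μ = ∫ x, g.gradSq f x ∂μ :=
    integral_congr_ae (Eventually.of_forall fun x ↦ Real.sq_sqrt (innerDual_self_nonneg h x _))
  rw [hsq] at hle
  calc (∫ x, |f x| ^ ((10 : ℝ) / 3) ∂μ) ^ ((3 : ℝ) / 10)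
      ≤ (A : ℝ) * (Real.sqrt (∫ x, g.gradSq f x ∂μ) * W.toReal) + (B : ℝ) * (Real.sqrt (∫ x, f x ^ 2 ∂μ) * W.toReal) := hle
    _ = (A : ℝ) * W.toReal * Real.sqrt (∫ x, g.gradSq f x ∂μ) + (B : ℝ) * W.toReal * Real.sqrt (∫ x, f x ^ 2 ∂μ) := by ring

/-- **Uniform `W^{1,2}` bound for unit vectors on which the Schrödinger form `∫|df|² − ∫Vf²` is
non-positive** (the compactness input of Karpukhin–Stern's Prop. 3.8, p. 753, in quantitative
form): on a closed Riemannian manifold of dimension `3 ≤ m ≤ 5`, for every `C ≥ 0` there is `R`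
such that for every continuous `V ≥ 0` with `∫ V³ ≤ C` and every `C¹` function `f` with
`∫ f² = 1` and `∫ |df|²_h ≤ ∫ V f²`, one has `∫ |df|²_h ≤ R`. (Hölder `3 – 3/2`, the interpolation
`∫|f|³ ≤ (∫f²)^{1/4}(∫|f|^{10/3})^{3/4}` and the Sobolev inequality give
`∫|df|² ≤ C^{1/3}(c₁ (∫|df|²)^{1/2} + c₂)^{5/3}`, sublinear in `∫|df|²`.)
[cite: KarpukhinStern2024, proof of Prop. 3.8 p. 753] -/
theorem exists_gradSq_le_of_schrodinger_nonpos (hm3 : 3 ≤ m) (hm5 : m ≤ 5) {C : ℝ} (hC : 0 ≤ C) :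
    ∃ R : ℝ, ∀ (V f : N → ℝ), Continuous V → (∀ x, 0 ≤ V x) →
      ∫ x, V x ^ 3 ∂riemannianMeasure h ≤ C → ContMDiff J 𝓘(ℝ, ℝ) 1 f →
      ∫ x, f x ^ 2 ∂riemannianMeasure h = 1 →
      ∫ x, (ofRiemannian h).gradSq f x ∂riemannianMeasure h ≤ ∫ x, V x * f x ^ 2 ∂riemannianMeasure h →
      ∫ x, (ofRiemannian h).gradSq f x ∂riemannianMeasure h ≤ R := by
  obtain ⟨c₁, c₂, hc₁, hc₂, hSob⟩ := exists_sobolev_ten_thirds h hm3 hm5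
  set c : ℝ := C ^ ((1 : ℝ) / 3) with hcdef
  have hc0 : 0 ≤ c := Real.rpow_nonneg hC _
  set K : ℝ := c * (c₁ + c₂) ^ ((5 : ℝ) / 3) with hKdef
  have hK0 : 0 ≤ K := mul_nonneg hc0 (Real.rpow_nonneg (by linarith) _)
  refine ⟨max 1 (K ^ (6 : ℕ)), fun V f hV hV0 hVC hf hf1 hQV ↦ ?_⟩
  set μ := riemannianMeasure h with hμ
  have hfc : Continuous f := hf.continuous
  set Q : ℝ := ∫ x, (ofRiemannian h).gradSq f x ∂μ with hQdef
  have hQ0 : 0 ≤ Q := integral_nonneg fun x ↦ innerDual_self_nonneg h x _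
  set t : ℝ := Real.sqrt Q with htdef
  have ht0 : 0 ≤ t := Real.sqrt_nonneg _
  have htQ : t ^ 2 = Q := Real.sq_sqrt hQ0
  -- (a) Hölder
  have hVC' : ∫ x, V x ^ (3 : ℝ) ∂μ ≤ C := by
    have : ∫ x, V x ^ (3 : ℝ) ∂μ = ∫ x, V x ^ 3 ∂μ :=
      integral_congr_ae (Eventually.of_forall fun x ↦ Real.rpow_ofNat (V x) 3)
    rw [this]
    exact hVC
  have hI3 : 0 ≤ ∫ x, |f x| ^ (3 : ℝ) ∂μ := integral_nonneg fun x ↦ Real.rpow_nonneg (abs_nonneg _) _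
  have hI103 : 0 ≤ ∫ x, |f x| ^ ((10 : ℝ) / 3) ∂μ :=
    integral_nonneg fun x ↦ Real.rpow_nonneg (abs_nonneg _) _
  have ha : ∫ x, V x * f x ^ 2 ∂μ ≤ c * (∫ x, |f x| ^ (3 : ℝ) ∂μ) ^ ((2 : ℝ) / 3) := by
    refine (integral_mul_sq_le_L3 h hV hV0 hfc).trans ?_
    refine mul_le_mul_of_nonneg_right ?_ (Real.rpow_nonneg hI3 _)
    exact Real.rpow_le_rpow (integral_nonneg fun x ↦ Real.rpow_nonneg (hV0 x) _) hVC' (by norm_num)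
  -- (b) interpolation with `∫ f² = 1`
  have hb : ∫ x, |f x| ^ (3 : ℝ) ∂μ ≤ (∫ x, |f x| ^ ((10 : ℝ) / 3) ∂μ) ^ ((3 : ℝ) / 4) := by
    have := integral_abs_cube_le h hfc
    rw [← hμ, hf1, Real.one_rpow, one_mul] at this
    exact this
  -- (c) Sobolev with `∫ f² = 1`
  have hcS : (∫ x, |f x| ^ ((10 : ℝ) / 3) ∂μ) ^ ((3 : ℝ) / 10) ≤ c₁ * t + c₂ := by
    have := hSob f hf
    rw [hf1, Real.sqrt_one, mul_one] at this
    exact this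
  have hct0 : 0 ≤ c₁ * t + c₂ := by positivity
  have hc' : ∫ x, |f x| ^ ((10 : ℝ) / 3) ∂μ ≤ (c₁ * t + c₂) ^ ((10 : ℝ) / 3) := by
    have h1 : ∫ x, |f x| ^ ((10 : ℝ) / 3) ∂μ =
        ((∫ x, |f x| ^ ((10 : ℝ) / 3) ∂μ) ^ ((3 : ℝ) / 10)) ^ ((10 : ℝ) / 3) := by
      rw [← Real.rpow_mul hI103]
      norm_num
    rw [h1]
    exact Real.rpow_le_rpow (Real.rpow_nonneg hI103 _) hcS (by norm_num)
  -- (d) combine: `Q ≤ c (c₁ t + c₂)^{5/3}`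
  have hd : Q ≤ c * (c₁ * t + c₂) ^ ((5 : ℝ) / 3) := by
    have h1 : Q ≤ c * (∫ x, |f x| ^ (3 : ℝ) ∂μ) ^ ((2 : ℝ) / 3) := hQV.trans ha
    have h2 : (∫ x, |f x| ^ (3 : ℝ) ∂μ) ^ ((2 : ℝ) / 3) ≤
        ((∫ x, |f x| ^ ((10 : ℝ) / 3) ∂μ) ^ ((3 : ℝ) / 4)) ^ ((2 : ℝ) / 3) :=
      Real.rpow_le_rpow hI3 hb (by norm_num)
    have h3 : ((∫ x, |f x| ^ ((10 : ℝ) / 3) ∂μ) ^ ((3 : ℝ) / 4)) ^ ((2 : ℝ) / 3) =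
        (∫ x, |f x| ^ ((10 : ℝ) / 3) ∂μ) ^ ((1 : ℝ) / 2) := by
      rw [← Real.rpow_mul hI103]
      norm_num
    have h4 : (∫ x, |f x| ^ ((10 : ℝ) / 3) ∂μ) ^ ((1 : ℝ) / 2) ≤
        ((c₁ * t + c₂) ^ ((10 : ℝ) / 3)) ^ ((1 : ℝ) / 2) := Real.rpow_le_rpow hI103 hc' (by norm_num)
    have h5 : ((c₁ * t + c₂) ^ ((10 : ℝ) / 3)) ^ ((1 : ℝ) / 2) = (c₁ * t + c₂) ^ ((5 : ℝ) / 3) := by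
      rw [← Real.rpow_mul hct0]
      norm_num
    calc Q ≤ c * (∫ x, |f x| ^ (3 : ℝ) ∂μ) ^ ((2 : ℝ) / 3) := h1
      _ ≤ c * (c₁ * t + c₂) ^ ((5 : ℝ) / 3) := by
          refine mul_le_mul_of_nonneg_left ?_ hc0
          calc (∫ x, |f x| ^ (3 : ℝ) ∂μ) ^ ((2 : ℝ) / 3) ≤ _ := h2
            _ = _ := h3
            _ ≤ _ := h4
            _ = _ := h5
  -- (e) the dichotomy `t ≤ 1` / `t > 1`
  change Q ≤ max 1 (K ^ (6 : ℕ))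
  rcases le_or_gt t 1 with ht1 | ht1
  · calc Q = t ^ 2 := htQ.symm
      _ ≤ 1 := by nlinarith
      _ ≤ max 1 (K ^ (6 : ℕ)) := le_max_left _ _
  · have htpos : 0 < t := by linarith
    have h1 : c₁ * t + c₂ ≤ (c₁ + c₂) * t := by nlinarith
    have h2 : (c₁ * t + c₂) ^ ((5 : ℝ) / 3) ≤ ((c₁ + c₂) * t) ^ ((5 : ℝ) / 3) :=
      Real.rpow_le_rpow hct0 h1 (by norm_num)
    have h3 : ((c₁ + c₂) * t) ^ ((5 : ℝ) / 3) = (c₁ + c₂) ^ ((5 : ℝ) / 3) * t ^ ((5 : ℝ) / 3) :=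
      Real.mul_rpow (by linarith) ht0
    have h4 : Q ≤ K * t ^ ((5 : ℝ) / 3) := by
      calc Q ≤ c * (c₁ * t + c₂) ^ ((5 : ℝ) / 3) := hd
        _ ≤ c * ((c₁ + c₂) ^ ((5 : ℝ) / 3) * t ^ ((5 : ℝ) / 3)) := by
            rw [← h3]; exact mul_le_mul_of_nonneg_left h2 hc0
        _ = K * t ^ ((5 : ℝ) / 3) := by rw [hKdef]; ring
    -- `t² ≤ K t^{5/3}` gives `t^{1/3} ≤ K`, `t ≤ K³`, `Q ≤ K⁶`
    have hsplit : t ^ 2 = t ^ ((5 : ℝ) / 3) * t ^ ((1 : ℝ) / 3) := by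
      rw [← Real.rpow_add htpos, ← Real.rpow_two]
      norm_num
    have h53 : 0 < t ^ ((5 : ℝ) / 3) := Real.rpow_pos_of_pos htpos _
    have h13 : t ^ ((1 : ℝ) / 3) ≤ K := by
      have : t ^ ((5 : ℝ) / 3) * t ^ ((1 : ℝ) / 3) ≤ t ^ ((5 : ℝ) / 3) * K := by
        rw [← hsplit, htQ, mul_comm]
        exact h4
      exact le_of_mul_le_mul_left this h53
    have htK : t ≤ K ^ (3 : ℕ) := by
      have h0 : 0 ≤ t ^ ((1 : ℝ) / 3) := Real.rpow_nonneg ht0 _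
      calc t = (t ^ ((1 : ℝ) / 3)) ^ (3 : ℕ) := by
            rw [← Real.rpow_natCast, ← Real.rpow_mul ht0]
            norm_num
        _ ≤ K ^ (3 : ℕ) := pow_le_pow_left₀ h0 h13 3
    calc Q = t ^ 2 := htQ.symm
      _ ≤ (K ^ (3 : ℕ)) ^ 2 := pow_le_pow_left₀ ht0 htK 2
      _ = K ^ (6 : ℕ) := by ring
      _ ≤ max 1 (K ^ (6 : ℕ)) := le_max_right _ _

end SobolevBound

/-! ### Part K — subspaces on which `∫|df|² ≤ ∫Vf²` have uniformly bounded dimension -/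

section DimensionBound

open Lorentzian Lorentzian.PseudoRiemannianMetric Bundle
open _root_.MeasureTheory

variable {m : ℕ} {H' : Type*} [TopologicalSpace H']
  {J : ModelWithCorners ℝ (EuclideanSpace ℝ (Fin m)) H'} [J.Boundaryless]
  {N : Type*} [TopologicalSpace N] [ChartedSpace H' N] [IsManifold J ∞ N] [CompactSpace N]
  [T2Space N] [T3Space N] [MeasurableSpace N] [BorelSpace N]
  (h : ContMDiffRiemannianMetric J ∞ (EuclideanSpace ℝ (Fin m)) (TangentSpace J : N → Type _))

omit [J.Boundaryless] in
/-- **The `L²(dv_h)` pairing on smooth functions**, as a bilinear form on a subspace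
`F ≤ C^∞(N)`. [folklore] -/
theorem exists_l2Bilin (F : Submodule ℝ (N → ℝ)) (hF : F ≤ smoothFunctions J N) :
    ∃ B : LinearMap.BilinForm ℝ F, ∀ f g : F,
      B f g = ∫ x, (f : N → ℝ) x * (g : N → ℝ) x ∂riemannianMeasure h := by
  have hc : ∀ f : F, Continuous (f : N → ℝ) := fun f ↦ (hF f.2).continuous
  have hint : ∀ f g : F, Integrable (fun x ↦ (f : N → ℝ) x * (g : N → ℝ) x) (riemannianMeasure h) :=
    fun f g ↦ integrable_of_continuous h ((hc f).mul (hc g))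
  refine ⟨LinearMap.mk₂ ℝ (fun f g ↦ ∫ x, (f : N → ℝ) x * (g : N → ℝ) x ∂riemannianMeasure h)
    ?_ ?_ ?_ ?_, fun f g ↦ rfl⟩
  · intro f f' g
    simp only [Submodule.coe_add, Pi.add_apply, add_mul]
    exact integral_add (hint f g) (hint f' g)
  · intro c f g
    simp only [Submodule.coe_smul, Pi.smul_apply, smul_eq_mul, mul_assoc]
    exact integral_const_mul c _
  · intro f g g'
    simp only [Submodule.coe_add, Pi.add_apply, mul_add]
    exact integral_add (hint f g) (hint f g')
  · intro c f g
    simp only [Submodule.coe_smul, Pi.smul_apply, smul_eq_mul, mul_left_comm _ c]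
    exact integral_const_mul c _

variable [(ofRiemannian h).HasLeviCivita]

omit [(ofRiemannian h).HasLeviCivita] in
/-- A continuous function with `∫ f² dv_h = 0` vanishes identically (the Riemannian measure
charges open sets). [folklore] -/
theorem eq_zero_of_integral_sq_eq_zero {f : N → ℝ} (hf : Continuous f)
    (h0 : ∫ x, f x ^ 2 ∂riemannianMeasure h = 0) : f = 0 := by
  haveI := isOpenPosMeasure_riemannianMeasure h
  have hae : (fun x ↦ f x ^ 2) =ᵐ[riemannianMeasure h] 0 :=
    (integral_eq_zero_iff_of_nonneg (fun x ↦ sq_nonneg (f x)) (integrable_of_continuous h (hf.pow 2))).1 h0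
  have hzero : (fun x ↦ f x ^ 2) = 0 := ((hf.pow 2).ae_eq_iff_eq (riemannianMeasure h) continuous_const).1 hae
  funext x
  have := congrFun hzero x
  simpa using this

omit [(ofRiemannian h).HasLeviCivita] in
/-- **Subspaces on which the Schrödinger form is non-positive have uniformly bounded
dimension** (the finiteness at the heart of Karpukhin–Stern's proof of Prop. 3.8, p. 753: the
coordinate spaces `C_k`, of dimension `m_k`, are null spaces of the forms `∫|df|² − ∫V_k f²` with
`‖V_k‖_{L³}` bounded, and "`m_k → ∞`" is impossible): on a closed Riemannian manifold of dimension
`3 ≤ m ≤ 5`, for every `C ≥ 0` there is `D` such that for every continuous `V ≥ 0` with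
`∫ V³ ≤ C`, every finite-dimensional subspace `F` of smooth functions with `∫|df|²_h ≤ ∫ V f²` for
all `f ∈ F` has `dim F ≤ D`. Proof: an `L²(dv_h)`-orthonormal basis of `F`
(`LinearMap.BilinForm.exists_orthogonal_basis`, the pairing being positive definite on continuous
functions), `exists_gradSq_le_of_schrodinger_nonpos` and `exists_bound_orthonormal_of_gradSq_le`.
[cite: KarpukhinStern2024, proof of Prop. 3.8 p. 753] -/
theorem exists_finrank_le_of_schrodinger_nonpos (hm3 : 3 ≤ m) (hm5 : m ≤ 5) {C : ℝ} (hC : 0 ≤ C) :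
    ∃ D : ℕ, ∀ (V : N → ℝ), Continuous V → (∀ x, 0 ≤ V x) → ∫ x, V x ^ 3 ∂riemannianMeasure h ≤ C →
      ∀ (F : Submodule ℝ (N → ℝ)), F ≤ smoothFunctions J N → FiniteDimensional ℝ F →
      (∀ f ∈ F, ∫ x, (ofRiemannian h).gradSq f x ∂riemannianMeasure h ≤
        ∫ x, V x * f x ^ 2 ∂riemannianMeasure h) → finrank ℝ F ≤ D := by
  classical
  obtain ⟨R, hR⟩ := exists_gradSq_le_of_schrodinger_nonpos h hm3 hm5 hC
  obtain ⟨D, hD⟩ := exists_bound_orthonormal_of_gradSq_le h R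
  refine ⟨D, fun V hV hV0 hVC F hF hFfin hform ↦ ?_⟩
  haveI := hFfin
  obtain ⟨B, hB⟩ := exists_l2Bilin h F hF
  have hc : ∀ f : F, Continuous (f : N → ℝ) := fun f ↦ (hF f.2).continuous
  have hBsymm : B.IsSymm := by
    refine ⟨fun f g ↦ ?_⟩
    rw [hB, hB]
    exact integral_congr_ae (Eventually.of_forall fun x ↦ mul_comm _ _)
  obtain ⟨v, hv⟩ := LinearMap.BilinForm.exists_orthogonal_basis (LinearMap.BilinForm.isSymm_iff.1 hBsymm)
  -- positivity of `B(vᵢ, vᵢ)`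
  have hpos : ∀ i, 0 < B (v i) (v i) := by
    intro i
    rw [hB]
    have hsq : ∫ x, (v i : N → ℝ) x * (v i : N → ℝ) x ∂riemannianMeasure h =
        ∫ x, (v i : N → ℝ) x ^ 2 ∂riemannianMeasure h :=
      integral_congr_ae (Eventually.of_forall fun x ↦ (sq _).symm)
    rw [hsq]
    refine lt_of_le_of_ne (integral_nonneg fun x ↦ sq_nonneg _) fun h0 ↦ ?_
    have hzero : ((v i : F) : N → ℝ) = 0 := eq_zero_of_integral_sq_eq_zero h (hc _) h0.symm
    exact v.ne_zero i (Subtype.ext hzero)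
  -- the normalised functions
  set w : Fin (finrank ℝ F) → N → ℝ := fun i ↦ fun x ↦ (Real.sqrt (B (v i) (v i)))⁻¹ * (v i : N → ℝ) x
    with hw
  have hwmem : ∀ i, w i ∈ F := fun i ↦ by
    have : w i = (Real.sqrt (B (v i) (v i)))⁻¹ • ((v i : F) : N → ℝ) := by
      funext x; simp [hw]
    rw [this]
    exact F.smul_mem _ (v i).2
  have hws : ∀ i, ContMDiff J 𝓘(ℝ, ℝ) ∞ (w i) := fun i ↦ hF (hwmem i)
  have horth : ∀ i j, ∫ x, w i x * w j x ∂riemannianMeasure h = if i = j then 1 else 0 := by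
    intro i j
    have h1 : ∫ x, w i x * w j x ∂riemannianMeasure h =
        (Real.sqrt (B (v i) (v i)))⁻¹ * (Real.sqrt (B (v j) (v j)))⁻¹ * B (v i) (v j) := by
      rw [hB (v i) (v j), ← integral_const_mul]
      refine integral_congr_ae (Eventually.of_forall fun x ↦ ?_)
      simp only [hw]
      ring
    rw [h1]
    split_ifs with hij
    · subst hij
      have hs : Real.sqrt (B (v i) (v i)) ^ 2 = B (v i) (v i) := Real.sq_sqrt (hpos i).le
      rw [← mul_inv, ← pow_two, hs, inv_mul_cancel₀ (hpos i).ne']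
    · have h0 : B (v i) (v j) = 0 := hv hij
      rw [h0, mul_zero]
  have hgrad : ∀ i, ∫ x, (ofRiemannian h).gradSq (w i) x ∂riemannianMeasure h ≤ R := by
    intro i
    have h1 : ∫ x, w i x ^ 2 ∂riemannianMeasure h = 1 := by
      have := horth i i
      simp only [if_true] at this
      rw [← this]
      exact integral_congr_ae (Eventually.of_forall fun x ↦ sq _)
    exact hR V (w i) hV hV0 hVC ((hws i).of_le (by exact_mod_cast le_top)) h1 (hform _ (hwmem i))
  exact hD (finrank ℝ F) w (fun i ↦ (hws i).of_le (by exact_mod_cast le_top)) horth hgrad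

end DimensionBound

/-! ### Part L — Karpukhin–Stern Proposition 3.8 from the uniform `L⁶` bound -/

section Prop38

open Lorentzian Lorentzian.PseudoRiemannianMetric Bundle
open _root_.MeasureTheory

variable {m : ℕ} {H' : Type*} [TopologicalSpace H']
  {J : ModelWithCorners ℝ (EuclideanSpace ℝ (Fin m)) H'} [J.Boundaryless]
  {N : Type*} [TopologicalSpace N] [ChartedSpace H' N] [IsManifold J ∞ N] [CompactSpace N]
  [T2Space N] [T3Space N] [MeasurableSpace N] [BorelSpace N]
  (h : ContMDiffRiemannianMetric J ∞ (EuclideanSpace ℝ (Fin m)) (TangentSpace J : N → Type _))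
  [(ofRiemannian h).HasLeviCivita]

omit [TopologicalSpace N] [CompactSpace N] [T2Space N] [T3Space N] [MeasurableSpace N] [BorelSpace N] in
/-- `a ↦ u_a` as a linear map `ℝᵏ⁺¹ → (N → ℝ)`. [cite: KarpukhinStern2024, proof of Lemma 3.3 p. 746] -/
theorem exists_sphereCompLin {k : ℕ} (u : N → Metric.sphere (0 : EuclideanSpace ℝ (Fin (k + 1))) 1) :
    ∃ T : EuclideanSpace ℝ (Fin (k + 1)) →ₗ[ℝ] (N → ℝ), ∀ a, T a = sphereComp u a :=
  ⟨{ toFun := fun a ↦ sphereComp u a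
     map_add' := fun a b ↦ funext fun x ↦ sphereComp_add u a b x
     map_smul' := fun c a ↦ funext fun x ↦ by
       rw [RingHom.id_apply, Pi.smul_apply, smul_eq_mul, sphereComp_smul] }, fun _ ↦ rfl⟩

/-- **Karpukhin–Stern, Proposition 3.8, from the uniform `L⁶` bound** (pp. 752–753: "there
exists `k₀(M, g) ∈ ℕ` such that for every smooth harmonic map `u : M → Sᵏ` with
`ind_E(u) ⩽ k + 1`, there exists a totally geodesic subsphere `S^{k₀} ⊂ Sᵏ` … such that
`u(M) ⊂ S^{k₀}`"). On a closed Riemannian manifold of dimension `3 ≤ m ≤ 5`, assume the conclusion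
(3.8) of Lemma 3.7: every nonconstant smooth harmonic `u : N → Sᵏ`, `k ≥ 205`, with
`ind_E(u) ≤ k + 1` has `∫ |du|⁶_h ≤ C`. Then there is `k₀` such that every smooth harmonic
`u : N → Sᵏ` (any `k`) with `ind_E(u) ≤ k + 1` has its image in a linear subspace of dimension
`≤ k₀` (namely `span u(N)`), i.e. in a totally geodesic `S^{k₀ − 1}`. PROOF (replacing the
weighted-eigenvalue continuity of [14] quoted in print by a direct compactness count): the
coordinate functions `u_a`, `a ∈ span u(N)`, form a space of dimension `dim span u(N)`
(`eq_zero_of_sphereComp_eq_zero`) on which `∫|df|² = ∫|du|² f²` (`integral_gradSq_sphereComp_eq`),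
and such spaces have uniformly bounded dimension once `‖|du|²‖_{L³}` is bounded
(`exists_finrank_le_of_schrodinger_nonpos`: Hölder, Sobolev, Rellich–Kondrachov).
[cite: KarpukhinStern2024, Prop. 3.8 pp. 752–753] -/
theorem karpukhinStern_prop38_of_L6bound (hm3 : 3 ≤ m) (hm5 : m ≤ 5) {C : ℝ} (hC : 0 ≤ C)
    (hL6 : ∀ {k : ℕ} (u : N → Metric.sphere (0 : EuclideanSpace ℝ (Fin (k + 1))) 1)
      (hu : ContMDiff J (𝓡 k) ∞ u),
      (∀ (i : Fin (k + 1)) (x : N), (ofRiemannian h).dalembertian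
        (fun y ↦ (u y : EuclideanSpace ℝ (Fin (k + 1))) i) x =
          -(energyDensity h u x) * (u x : EuclideanSpace ℝ (Fin (k + 1))) i) →
      (∃ x y, u x ≠ u y) → 205 ≤ k → energyIndex h hu ≤ (k + 1 : ℕ) →
      ∫ x, energyDensity h u x ^ 3 ∂riemannianMeasure h ≤ C) :
    ∃ k₀ : ℕ, ∀ {k : ℕ} (u : N → Metric.sphere (0 : EuclideanSpace ℝ (Fin (k + 1))) 1)
      (hu : ContMDiff J (𝓡 k) ∞ u),
      (∀ (i : Fin (k + 1)) (x : N), (ofRiemannian h).dalembertian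
        (fun y ↦ (u y : EuclideanSpace ℝ (Fin (k + 1))) i) x =
          -(energyDensity h u x) * (u x : EuclideanSpace ℝ (Fin (k + 1))) i) →
      energyIndex h hu ≤ (k + 1 : ℕ) →
      finrank ℝ (Submodule.span ℝ (Set.range fun x ↦ (u x : EuclideanSpace ℝ (Fin (k + 1))))) ≤ k₀ := by
  classical
  obtain ⟨D, hD⟩ := exists_finrank_le_of_schrodinger_nonpos h hm3 hm5 hC
  refine ⟨max 205 D, fun {k} u hu harm hind ↦ ?_⟩
  set P := Submodule.span ℝ (Set.range fun x ↦ (u x : EuclideanSpace ℝ (Fin (k + 1)))) with hP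
  -- small `k`: `dim P ≤ k + 1 ≤ 205`
  by_cases hk : k < 205
  · have h1 : finrank ℝ P ≤ finrank ℝ (EuclideanSpace ℝ (Fin (k + 1))) := Submodule.finrank_le P
    rw [finrank_euclideanSpace_fin] at h1
    exact (h1.trans (by omega)).trans (le_max_left _ _)
  push Not at hk
  -- constant maps: `P` is spanned by one point
  by_cases hne : ∃ x y, u x ≠ u y
  swap
  · push Not at hne
    have hle1 : finrank ℝ P ≤ 1 := by
      rcases isEmpty_or_nonempty N with hN | ⟨⟨x₀⟩⟩
      · have : Set.range (fun x : N ↦ (u x : EuclideanSpace ℝ (Fin (k + 1)))) = ∅ := Set.range_eq_empty _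
        rw [hP, this, Submodule.span_empty, finrank_bot]
        exact zero_le_one
      · have : Set.range (fun x : N ↦ (u x : EuclideanSpace ℝ (Fin (k + 1)))) =
            {(u x₀ : EuclideanSpace ℝ (Fin (k + 1)))} := by
          ext v
          simp only [Set.mem_range, Set.mem_singleton_iff]
          constructor
          · rintro ⟨x, rfl⟩; rw [hne x x₀]
          · rintro rfl; exact ⟨x₀, rfl⟩
        rw [hP, this]
        exact (finrank_span_le_card _).trans (by simp)
    exact hle1.trans ((by norm_num : (1 : ℕ) ≤ 205).trans (le_max_left _ _))
  -- the main case
  have hL := hL6 u hu harm hne hk hind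
  set V := energyDensity h u with hVdef
  have hVc : Continuous V := continuous_energyDensity h hu
  have hV0 : ∀ x, 0 ≤ V x := fun x ↦ energyDensity_nonneg' h u x
  obtain ⟨T, hT⟩ := exists_sphereCompLin u
  set F : Submodule ℝ (N → ℝ) := P.map T with hF
  have hFle : F ≤ smoothFunctions J N := by
    rintro f ⟨a, -, rfl⟩
    rw [hT]
    exact contMDiff_sphereComp hu a
  haveI : FiniteDimensional ℝ F := Module.Finite.map P T
  have hform : ∀ f ∈ F, ∫ x, (ofRiemannian h).gradSq f x ∂riemannianMeasure h ≤
      ∫ x, V x * f x ^ 2 ∂riemannianMeasure h := by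
    rintro f ⟨a, -, rfl⟩
    rw [hT]
    exact (integral_gradSq_sphereComp_eq h hu harm a).le
  have hdim : finrank ℝ F = finrank ℝ P := by
    have hinj : Function.Injective (T.domRestrict P) := by
      intro a b hab
      apply Subtype.ext
      have h0 : T ((a : EuclideanSpace ℝ (Fin (k + 1))) - b) = 0 := by
        rw [map_sub]
        exact sub_eq_zero.2 hab
      rw [hT] at h0
      have := eq_zero_of_sphereComp_eq_zero u (P.sub_mem a.2 b.2) (fun x ↦ congrFun h0 x)
      exact sub_eq_zero.1 this
    have hrange : LinearMap.range (T.domRestrict P) = F := LinearMap.range_domRestrict P T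
    rw [← hrange]
    exact LinearMap.finrank_range_of_inj hinj
  have key := hD V hVc hV0 hL F hFle inferInstance hform
  rw [hdim] at key
  exact key.trans (le_max_right _ _)

end Prop38

end KarpukhinStern

end Literature.Geometry.Riemannian
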